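import Summits.QuantumFields.BalabanUV.Beta.GAN24.LegPushGaugePairings

/-!
# `BalabanUV.Beta.GAN24.LegPushDressedBound` — binder row G-an2-4 ∕ (CONV-C), W-slot, the (α-0) parity re-cut, located crux (Q-L-k₀) (RULING R-gan24p1-g36-1 (4d)):
# **THE (E-a) WINDOW — DRESSING BOTH SLOT LEGS OF THE THREE-LEG PUSH COSTS ONLY A `Cg(k₀)·g′` TERM.**
For abstract legs at blocking `L` — kernel leg `l` (sup `a_ρ·E_{x′}`), slot legs `r` (sup `a·E_y`), gauge potential `φ` (sup `a_φ·E_y`), `E_y(v) = e^{−κ₀‖quo L v − y‖∞}` —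
and a table `W` (bounded, with slot-DIVERGENCE rows `g′`), the push of the block-summed table through the DRESSED slot legs `r^E μ y κ v := r μ y κ v + (φ μ y (v+e_κ) − φ μ y v)`
differs from the bare push, entry by entry, by at most `|Fib d|·a_ρ·g′·(d+1)·(2a·a_φ + a_φ²·(e^{3δ}+1))·K₀·e^{−(κ₀/18)(‖u′−u‖∞+‖x′−u‖∞+‖z−u‖∞)}`,
`K₀ = e^{5κ₀}·Zl(δ/2)³·L^{d+1}·Zl(κ₀/(2(d+1)))` (`0 < κ₀ ≤ (δ/6)·L`); whence, with `LegStepPush.locStencil₂_legPush_bsum` (bare legs, double first-moment freezing,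
slot-CHARGE rows `g`, unit gradient `a′`, `LocStencil₂ W C δ`):
`LocStencil₂ (legPush l r^E (bsum L ∘ W)) (|Fib d|·(d+1)²·a_ρ·Jc·L^{d+1}·Zl + |Fib d|·a_ρ·g′·(d+1)·(2a·a_φ + a_φ²(e^{3δ}+1))·K₀) (κ₀/(18(d+1)))` —
the gauge dressing never multiplies the table's `LocStencil₂` constant `C` (RULING (4a) respected), it only adds charge-currency terms.

NOT IN PRINT; OUR PROOF ([folklore] bookkeeping over `LegPushGaugePairings` + `LegPushGaugeSplit.vertex2W_dressed_eq`; 0 `def`, 0 cited facts, 0 `def … : Prop`,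
0 sorry, 0 wall binders).  HONEST FRAMING (cell contract, verbatim): «discharging `BetaPertH` makes Bałaban's UV stability UNCONDITIONAL — a real constructive-QFT
result; it is NOT the continuum limit and NOT the Clay problem.»  HONEST DEPENDENCY (verbatim): «continuum YM on T⁴ ⇐ BetaPertH ∧ nine spine estimates (0/9 proved);
BetaPertH ⇐ (D1) ∧ (D4) ∧ CAP+tail; G-an2-4 gates asym, D1 and NE2/3/4.»

* helpers `summable_mul_of_bdd`, `abs_tsum_mul_le_of_bdd`, `abs_divV_le_of_bdd`, `summable_of_env`;
* `vertex2W_dressed_bsum_entry` — the dressed double vertex of `bsum L ∘ W` at one entry `= bare + (A + B + C)` (the three pairings of `LegPushGaugePairings`);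
* `abs_gaugeLayer_le` — `|Σ'_x l α x′ f x·(A+B+C)(x)| ≤ a_ρ·g′·(d+1)·(2a·a_φ + a_φ²(e^{3δ}+1))·K₀·e^{−(κ₀/6)·spread}` (one ordering; summable);
* **`abs_legPush_dressed_sub_inl_le`** — the displayed entry bound (both orderings of the symmetrisation, rate `κ₀/18`);
* **`locStencil₂_legPush_dressed_of_bare`** (any bare envelope bound `CB·e^{−(κ₀/18)·spread}` ⟹ the dressed `LocStencil₂` window with constant `CB + gauge`) and
  **`locStencil₂_legPush_dressed_bsum`** (the displayed (E-a) window, bare part from `LegStepPush.abs_legPush_bsum_inl_le`).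
What remains for (H1♮) (INTENT lines of leaf-01 g74, journal): (E-b) the OWNER gan24-p1 g36's block-ℓ¹ rows for the DRESSED KERNEL leg; (E-c) the k₀-fold window
via `LegChainPushBound` with the composite legs + `|Πkc| ≤ L^{3(d+1)}` + `LegWindowArithmetic`; (E-d) the socket call with GoodL := slot-charge ∧ slot-divergence rows.
NOT (H1♮); NEVER «G-an2-4 closed» as (CONV-C); NOT D1, NOT `BetaPertH`, NOT continuum, NOT Clay; not in print.
Unit `b2b-balaban-gan24-formalise-leaf-01` (G-an2-4 formalisation swarm, leaf prover 01, gen 74), 2026-08-23.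
-/

noncomputable section

open Finset
open scoped BigOperators
open Literature.MathematicalPhysics.QuantumFieldTheory.LatticeForm (quo)
open Literature.MathematicalPhysics.QuantumFieldTheory.Balaban1983to89
open Literature.MathematicalPhysics.QuantumFieldTheory.Balaban1983to89.Beta
open B4ContourShift (supNorm)
open B6BondElimination (unitVec)
open B12Sec2to5 (l1 l1_nonneg)
open ExpKernelCalculus (MKer Zl Zl_nonneg Zl_pos l1_sub_triangle l1_sub_symm)
open OneStepResolventKernel (Fib)
open AffineAveraging (box toSite)
open KernelWard (divV)
open Summit.QuantumFields.BalabanUV.Beta.GAN24.BiStencilZeroMode (Tab)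
open Summit.QuantumFields.BalabanUV.Beta.GAN24.Push4 (vertexW vertexW_apply vertex2W)
open BalabanCompositeJets (LocStencil₂ LocStencil₂.nonneg)
open Summit.QuantumFields.BalabanUV.Beta.GAN24.LegStepPush (abs_legPush_bsum_inl_le)
open Summit.QuantumFields.BalabanUV.Beta.GAN24.LegStepPush (legPush legPush_inl legPush_inr supNorm_sub_comm)
open Summit.QuantumFields.BalabanUV.Beta.GAN24.LegPushNestAux (abs_vertexW_le_of_bdd)
open Summit.QuantumFields.BalabanUV.Beta.GAN24.LegPushGaugeSplit (vertex2W_dressed_eq)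
open Summit.QuantumFields.BalabanUV.Beta.GAN24.ThreeLegDoubleFreezeSummable (locStencil₂_of_env_bound)
open B4Reflection242 (supNorm_add_le)
open B4ContourShift (supNorm_nonneg)
open Summit.QuantumFields.BalabanUV.Beta.GAN24.Lin4LegTower (bsum bsum_apply)
open Summit.QuantumFields.BalabanUV.Beta.GAN24.EnvelopeBlockSum (env_le_one summable_env)
open Summit.QuantumFields.BalabanUV.Beta.GAN24.LegPushGaugeSplit (divV_apply_entry)
open Summit.QuantumFields.BalabanUV.Beta.GAN24.ThreeLegSupBound (middle_sup_le abs_threeLeg_sup_le)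

open Summit.QuantumFields.BalabanUV.Beta.GAN24.LegPushGaugePairings (divV_bsum_entry summable_env_mul abs_pairingA_le abs_pairingB_le abs_pairingC_le)

namespace Summit.QuantumFields.BalabanUV.Beta.GAN24.LegPushDressedBound

variable {d : ℕ}

/-! ## §4 The dressed double vertex of a block-summed table, entrywise; the gauge layer; the `legPush` packaging -/

/-- [folklore] A summable weight times a bounded factor is summable. -/
theorem summable_mul_of_bdd {g F : (Fin (d + 1) → ℤ) → ℝ} {M : ℝ} (hs : Summable g) (hF : ∀ w, |F w| ≤ M) :
    Summable fun w => g w * F w := by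
  refine Summable.of_norm_bounded (hs.abs.mul_right M) fun w => ?_
  rw [Real.norm_eq_abs, abs_mul]
  exact mul_le_mul_of_nonneg_left (hF w) (abs_nonneg _)

/-- [folklore] `|Σ'_w g w·F w| ≤ (Σ'_w |g w|)·M` for a summable weight and a bounded factor. -/
theorem abs_tsum_mul_le_of_bdd {g F : (Fin (d + 1) → ℤ) → ℝ} {M : ℝ} (hs : Summable g) (hF : ∀ w, |F w| ≤ M) :
    |∑' w, g w * F w| ≤ (∑' w, |g w|) * M := by
  have hb := tsum_of_norm_bounded (hs.abs.mul_right M).hasSum (f := fun w => g w * F w) fun w => by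
    rw [Real.norm_eq_abs, abs_mul]; exact mul_le_mul_of_nonneg_left (hF w) (abs_nonneg _)
  rw [Real.norm_eq_abs, tsum_mul_right] at hb
  exact hb

/-- [folklore] The first-bond divergence of a bounded family is bounded: `|divV S w (x,z,a,b)| ≤ (d+1)·2·CS`. -/
theorem abs_divV_le_of_bdd {S : Fin (d + 1) → (Fin (d + 1) → ℤ) → MKer (d + 1) (Fib d)} {CS : ℝ}
    (hS : ∀ κ v x z a b, |S κ v x z a b| ≤ CS) (w x z : Fin (d + 1) → ℤ) (a b : Fib d) :
    |divV S w x z a b| ≤ ((d : ℝ) + 1) * (CS + CS) := by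
  rw [divV_apply_entry]
  refine (Finset.abs_sum_le_sum_abs _ _).trans ((Finset.sum_le_sum fun κ _ =>
    (abs_sub _ _).trans (add_le_add (hS _ _ _ _ _ _) (hS _ _ _ _ _ _))).trans (le_of_eq ?_))
  rw [Finset.sum_const, Finset.card_univ, Fintype.card_fin, nsmul_eq_mul]; push_cast; ring

/-- [folklore] An envelope-bounded weight is summable. -/
theorem summable_of_env {L : ℕ} (hL : 1 ≤ L) {κ₀ a : ℝ} (hκ : 0 < κ₀) {c : Fin (d + 1) → ℤ} {h : (Fin (d + 1) → ℤ) → ℝ}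
    (hh : ∀ v, |h v| ≤ a * Real.exp (-(κ₀ * supNorm (quo L v - c)))) : Summable h := by
  have h1 := summable_env_mul hL hκ hh (F := fun _ => (1 : ℝ)) (M := 1) (fun _ => by simp)
  simpa using h1

section Dressed

variable {L : ℕ} {κ₀ δ a aφ aρ g' CW : ℝ}
  {l : Fin (d + 1) → (Fin (d + 1) → ℤ) → Fib d → (Fin (d + 1) → ℤ) → ℝ}
  {r : Fin (d + 1) → (Fin (d + 1) → ℤ) → Fin (d + 1) → (Fin (d + 1) → ℤ) → ℝ}
  {φ : Fin (d + 1) → (Fin (d + 1) → ℤ) → (Fin (d + 1) → ℤ) → ℝ} {W : Tab d}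
  (hL : 1 ≤ L) (hκ : 0 < κ₀) (hδ : 0 < δ) (hgap : κ₀ ≤ δ / 6 * L)
  (ha : 0 ≤ a) (haφ : 0 ≤ aφ) (haρ : 0 ≤ aρ) (hg : 0 ≤ g')
  (hr : ∀ μ y κ v, |r μ y κ v| ≤ a * Real.exp (-(κ₀ * supNorm (quo L v - y))))
  (hφ : ∀ μ y v, |φ μ y v| ≤ aφ * Real.exp (-(κ₀ * supNorm (quo L v - y))))
  (hl : ∀ α x' f x, |l α x' f x| ≤ aρ * Real.exp (-(κ₀ * supNorm (quo L x - x'))))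
  (hWb : ∀ κ u κ' u' x z a b, |W κ u κ' u' x z a b| ≤ CW)
  (hD₂ : ∀ κ v w x p f b, |∑ μ, (W κ v μ (w - unitVec μ) x p f b - W κ v μ w x p f b)|
    ≤ g' * Real.exp (-δ * l1 (w - v)) * Real.exp (-δ * (l1 (x - v) + l1 (p - v))))
  (hD₁ : ∀ κ' w v' x p f b, |∑ κ, (W κ (w - unitVec κ) κ' v' x p f b - W κ w κ' v' x p f b)|
    ≤ g' * Real.exp (-δ * l1 (v' - w)) * Real.exp (-δ * (l1 (x - w) + l1 (p - w))))

include hL hκ hr hφ hWb in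
/-- NOT IN PRINT; OUR BOOKKEEPING.  **THE DRESSED DOUBLE VERTEX OF A BLOCK-SUMMED TABLE, ENTRYWISE** (`LegPushGaugeSplit.vertex2W_dressed_eq` read at one entry,
the last pairing split): `vertex2W (r + d_zφ) (bsum L ∘ W) μ y ν y′ (x,z,f,b) = vertex2W r (bsum L ∘ W) μ y ν y′ (x,z,f,b) + (A + B + C)`. -/
theorem vertex2W_dressed_bsum_entry (μ : Fin (d + 1)) (y : Fin (d + 1) → ℤ) (ν : Fin (d + 1)) (y' : Fin (d + 1) → ℤ)
    (x z : Fin (d + 1) → ℤ) (f b : Fib d) :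
    vertex2W (fun μ y κ v => r μ y κ v + (φ μ y (v + unitVec κ) - φ μ y v)) (fun κ₁ v κ₂ v' => bsum L (W κ₁ v κ₂ v')) μ y ν y' x z f b
      = vertex2W r (fun κ₁ v κ₂ v' => bsum L (W κ₁ v κ₂ v')) μ y ν y' x z f b
        + (vertexW r (fun κ u => fun x z f b => ∑' w', φ ν y' w' * divV (fun μ' w'' => bsum L (W κ u μ' w'')) w' x z f b) μ y x z f b
          + ∑' w, φ μ y w * divV (fun κ u => vertexW r (fun μ' w'' => bsum L (W κ u μ' w'')) ν y') w x z f b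
          + ∑' w, φ μ y w * divV (fun κ u => fun x z f b => ∑' w', φ ν y' w' * divV (fun μ' w'' => bsum L (W κ u μ' w'')) w' x z f b) w x z f b) := by
  have hrs : ∀ μ y κ, Summable fun v => r μ y κ v := fun μ y κ => summable_of_env hL hκ (hr μ y κ)
  have hφs : ∀ μ y, Summable fun v => φ μ y v := fun μ y => summable_of_env hL hκ (hφ μ y)
  have hXb : ∀ κ u κ' u' x z a b, |bsum L (W κ u κ' u') x z a b| ≤ (box (d + 1) L).card * CW := by
    intro κ u κ' u' x z a b
    rw [bsum_apply]
    refine (Finset.abs_sum_le_sum_abs _ _).trans ((Finset.sum_le_sum fun t _ => hWb κ u κ' u' x _ a b).trans (le_of_eq ?_))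
    rw [Finset.sum_const, nsmul_eq_mul]
  -- bounded columns ⇒ the last pairing splits
  have BG : ∀ κ w x z a b, |vertexW r (fun μ' w'' => bsum L (W κ w μ' w'')) ν y' x z a b| ≤ (∑ κ', ∑' u', |r ν y' κ' u'|) * ((box (d + 1) L).card * CW) :=
    fun κ w x z a b => abs_vertexW_le_of_bdd (r := r) (T := fun μ' w'' => bsum L (W κ w μ' w'')) hrs (fun lam v w₁ z₁ f₁ b₁ => hXb κ w lam v w₁ z₁ f₁ b₁) ν y' x z a b
  have BdX : ∀ κ u w' x z a b, |divV (fun μ' w'' => bsum L (W κ u μ' w'')) w' x z a b| ≤ ((d : ℝ) + 1) * ((box (d + 1) L).card * CW + (box (d + 1) L).card * CW) :=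
    fun κ u w' x z a b => abs_divV_le_of_bdd (fun lam v x z a b => hXb κ u lam v x z a b) w' x z a b
  have BP : ∀ κ u x z a b, |(fun x z f b => ∑' w', φ ν y' w' * divV (fun μ' w'' => bsum L (W κ u μ' w'')) w' x z f b) x z a b|
      ≤ (∑' w', |φ ν y' w'|) * (((d : ℝ) + 1) * ((box (d + 1) L).card * CW + (box (d + 1) L).card * CW)) :=
    fun κ u x z a b => abs_tsum_mul_le_of_bdd (hφs ν y') (fun w' => BdX κ u w' x z a b)
  have hsB : Summable fun w => φ μ y w * divV (fun κ u => vertexW r (fun μ' w'' => bsum L (W κ u μ' w'')) ν y') w x z f b :=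
    summable_mul_of_bdd (hφs μ y) fun w => abs_divV_le_of_bdd (fun κ v x z a b => BG κ v x z a b) w x z f b
  have hsC : Summable fun w => φ μ y w *
      divV (fun κ u => fun x z f b => ∑' w', φ ν y' w' * divV (fun μ' w'' => bsum L (W κ u μ' w'')) w' x z f b) w x z f b :=
    summable_mul_of_bdd (hφs μ y) fun w => abs_divV_le_of_bdd (fun κ v x z a b => BP κ v x z a b) w x z f b
  have h := vertex2W_dressed_eq (X := fun κ₁ v κ₂ v' => bsum L (W κ₁ v κ₂ v')) (CX := (box (d + 1) L).card * CW) hrs hφs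
    (fun κ u κ' u' x z a b => hXb κ u κ' u' x z a b) μ y ν y'
  have hx := congrFun (congrFun (congrFun (congrFun h x) z) f) b
  simp only [Pi.add_apply] at hx
  refine hx.trans ?_
  have e3 : ∑' w, φ μ y w * (divV (fun κ u => vertexW r (fun μ' w'' => bsum L (W κ u μ' w'')) ν y') w x z f b
        + divV (fun κ u => fun x z f b => ∑' w', φ ν y' w' * divV (fun μ' w'' => bsum L (W κ u μ' w'')) w' x z f b) w x z f b)
      = (∑' w, φ μ y w * divV (fun κ u => vertexW r (fun μ' w'' => bsum L (W κ u μ' w'')) ν y') w x z f b)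
        + ∑' w, φ μ y w * divV (fun κ u => fun x z f b => ∑' w', φ ν y' w' * divV (fun μ' w'' => bsum L (W κ u μ' w'')) w' x z f b) w x z f b := by
    simp_rw [mul_add]
    exact hsB.tsum_add hsC
  rw [e3]
  simp only [vertex2W]
  ring

include hL hκ hδ hgap ha haφ haρ hg hr hφ hl hWb hD₂ hD₁ in
/-- NOT IN PRINT; OUR PROOF.  **THE GAUGE LAYER OF ONE ORDERING IS A `Cg·g′` TERM**: the kernel leg row `l α x′ f` against `A + B + C` of
`vertex2W_dressed_bsum_entry`: `|Σ'_x l α x′ f x·(A+B+C)(x)| ≤ a_ρ·g′·(d+1)·(2·a·a_φ + a_φ²·(e^{3δ}+1))·K₀·e^{−(κ₀/6)(‖y′−y‖∞+‖x′−y‖∞+‖z−y‖∞)}`,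
`K₀ = e^{5κ₀}·Zl(δ/2)³·L^{d+1}·Zl(κ₀/(2(d+1)))` (summable summand). -/
theorem abs_gaugeLayer_le (μ : Fin (d + 1)) (y : Fin (d + 1) → ℤ) (ν : Fin (d + 1)) (y' : Fin (d + 1) → ℤ)
    (α : Fin (d + 1)) (x' z : Fin (d + 1) → ℤ) (f b : Fib d) :
    (Summable fun x => l α x' f x *
      (vertexW r (fun κ u => fun x z f b => ∑' w', φ ν y' w' * divV (fun μ' w'' => bsum L (W κ u μ' w'')) w' x z f b) μ y x z f b
        + ∑' w, φ μ y w * divV (fun κ u => vertexW r (fun μ' w'' => bsum L (W κ u μ' w'')) ν y') w x z f b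
        + ∑' w, φ μ y w * divV (fun κ u => fun x z f b => ∑' w', φ ν y' w' * divV (fun μ' w'' => bsum L (W κ u μ' w'')) w' x z f b) w x z f b)) ∧
    |∑' x, l α x' f x *
      (vertexW r (fun κ u => fun x z f b => ∑' w', φ ν y' w' * divV (fun μ' w'' => bsum L (W κ u μ' w'')) w' x z f b) μ y x z f b
        + ∑' w, φ μ y w * divV (fun κ u => vertexW r (fun μ' w'' => bsum L (W κ u μ' w'')) ν y') w x z f b
        + ∑' w, φ μ y w * divV (fun κ u => fun x z f b => ∑' w', φ ν y' w' * divV (fun μ' w'' => bsum L (W κ u μ' w'')) w' x z f b) w x z f b)|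
      ≤ aρ * g' * (((d : ℝ) + 1) * (2 * (a * aφ) + aφ * aφ * (Real.exp δ ^ 3 + 1))) *
        (Real.exp κ₀ ^ 5 * Zl (d + 1) (δ / 2) ^ 3 * ((L : ℝ) ^ (d + 1) * Zl (d + 1) (κ₀ / (2 * ((d : ℝ) + 1))))) *
          Real.exp (-(κ₀ / 6) * (supNorm (y' - y) + supNorm (x' - y) + supNorm (z - y))) := by
  have pA := abs_pairingA_le (r := r) (φ := φ) (W := W) (ρ := fun x => l α x' f x) (μ₀ := μ) (y₀ := y) (ν₀ := ν) (y₀' := y') (x' := x') (y := z) (f := f) (b := b)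
    hL hκ hδ hgap ha haφ haρ hg (fun κ v => hr μ y κ v) (fun w => hφ ν y' w) (fun x => hl α x' f x) (fun κ v w x p => hD₂ κ v w x p f b)
  have pB := abs_pairingB_le (r := r) (φ := φ) (W := W) (ρ := fun x => l α x' f x) (μ₀ := μ) (y₀ := y) (ν₀ := ν) (y₀' := y') (x' := x') (y := z) (f := f) (b := b)
    hL hκ hδ hgap ha haφ haρ hg (fun w => hφ μ y w) (fun κ v => hr ν y' κ v) (fun x => hl α x' f x) hWb (fun κ' w v' x p => hD₁ κ' w v' x p f b)
  have pC := abs_pairingC_le (φ := φ) (W := W) (ρ := fun x => l α x' f x) (μ₀ := μ) (y₀ := y) (ν₀ := ν) (y₀' := y') (x' := x') (y := z) (f := f) (b := b)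
    hL hκ hδ hgap haφ haφ haρ hg (fun w => hφ μ y w) (fun w' => hφ ν y' w') (fun x => hl α x' f x) hWb (fun κ v w x p => hD₂ κ v w x p f b)
  have esplit : ∀ x, l α x' f x *
      (vertexW r (fun κ u => fun x z f b => ∑' w', φ ν y' w' * divV (fun μ' w'' => bsum L (W κ u μ' w'')) w' x z f b) μ y x z f b
        + ∑' w, φ μ y w * divV (fun κ u => vertexW r (fun μ' w'' => bsum L (W κ u μ' w'')) ν y') w x z f b
        + ∑' w, φ μ y w * divV (fun κ u => fun x z f b => ∑' w', φ ν y' w' * divV (fun μ' w'' => bsum L (W κ u μ' w'')) w' x z f b) w x z f b)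
      = l α x' f x * vertexW r (fun κ u => fun x z f b => ∑' w', φ ν y' w' * divV (fun μ' w'' => bsum L (W κ u μ' w'')) w' x z f b) μ y x z f b
        + l α x' f x * ∑' w, φ μ y w * divV (fun κ u => vertexW r (fun μ' w'' => bsum L (W κ u μ' w'')) ν y') w x z f b
        + l α x' f x * ∑' w, φ μ y w *
            divV (fun κ u => fun x z f b => ∑' w', φ ν y' w' * divV (fun μ' w'' => bsum L (W κ u μ' w'')) w' x z f b) w x z f b := fun x => by ring
  simp_rw [esplit]
  refine ⟨(pA.1.add pB.1).add pC.1, ?_⟩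
  rw [(pA.1.add pB.1).tsum_add pC.1, pA.1.tsum_add pB.1]
  have h3 := (abs_add_le _ _).trans (add_le_add ((abs_add_le _ _).trans (add_le_add pA.2 pB.2)) pC.2)
  refine h3.trans (le_of_eq ?_)
  ring

include hL hκ hδ hgap ha haφ haρ hg hr hφ hl hWb hD₂ hD₁ in
/-- NOT IN PRINT; OUR PROOF.  **DRESSING BOTH SLOT LEGS COSTS A `Cg·g′` TERM PER ENTRY** (field rows): `|legPush l (r + d_zφ) (bsum L ∘ W) κ u κ′ u′ x′ z (inl α) b
− legPush l r (bsum L ∘ W) κ u κ′ u′ x′ z (inl α) b| ≤ |Fib d|·a_ρ·g′·(d+1)·(2·a·a_φ + a_φ²·(e^{3δ}+1))·K₀·e^{−(κ₀/18)(‖u′−u‖∞+‖x′−u‖∞+‖z−u‖∞)}` (both orderings of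
the symmetrisation; the swapped one is centred at the other slot, whence `κ₀/18`). -/
theorem abs_legPush_dressed_sub_inl_le (κ : Fin (d + 1)) (u : Fin (d + 1) → ℤ) (κ' : Fin (d + 1)) (u' : Fin (d + 1) → ℤ)
    (x' z : Fin (d + 1) → ℤ) (α : Fin (d + 1)) (b : Fib d) :
    |legPush l (fun μ y κ v => r μ y κ v + (φ μ y (v + unitVec κ) - φ μ y v)) (fun κ₁ v κ₂ v' => bsum L (W κ₁ v κ₂ v')) κ u κ' u' x' z (Sum.inl α) b
      - legPush l r (fun κ₁ v κ₂ v' => bsum L (W κ₁ v κ₂ v')) κ u κ' u' x' z (Sum.inl α) b|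
      ≤ (Fintype.card (Fib d) : ℝ) * (aρ * g' * (((d : ℝ) + 1) * (2 * (a * aφ) + aφ * aφ * (Real.exp δ ^ 3 + 1))) *
        (Real.exp κ₀ ^ 5 * Zl (d + 1) (δ / 2) ^ 3 * ((L : ℝ) ^ (d + 1) * Zl (d + 1) (κ₀ / (2 * ((d : ℝ) + 1)))))) *
          Real.exp (-(κ₀ / 18) * (supNorm (u' - u) + supNorm (x' - u) + supNorm (z - u))) := by
  set KG : ℝ := aρ * g' * (((d : ℝ) + 1) * (2 * (a * aφ) + aφ * aφ * (Real.exp δ ^ 3 + 1))) *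
        (Real.exp κ₀ ^ 5 * Zl (d + 1) (δ / 2) ^ 3 * ((L : ℝ) ^ (d + 1) * Zl (d + 1) (κ₀ / (2 * ((d : ℝ) + 1))))) with hKG
  have hZ2 := Zl_nonneg (D := d + 1) (show 0 < δ / 2 by positivity)
  have hZκ := Zl_nonneg (D := d + 1) (show 0 < κ₀ / (2 * ((d : ℝ) + 1)) by positivity)
  have hKG0 : 0 ≤ KG := by rw [hKG]; positivity
  set S : ℝ := supNorm (u' - u) + supNorm (x' - u) + supNorm (z - u) with hS
  -- the gauge layers of the two orderings
  obtain ⟨G, hGdef⟩ : ∃ G : Fin (d + 1) → (Fin (d + 1) → ℤ) → Fin (d + 1) → (Fin (d + 1) → ℤ) → (Fin (d + 1) → ℤ) → Fib d → ℝ,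
      G = fun μ y ν y' x f =>
        vertexW r (fun κ u => fun x z f b => ∑' w', φ ν y' w' * divV (fun μ' w'' => bsum L (W κ u μ' w'')) w' x z f b) μ y x z f b
          + ∑' w, φ μ y w * divV (fun κ u => vertexW r (fun μ' w'' => bsum L (W κ u μ' w'')) ν y') w x z f b
          + ∑' w, φ μ y w * divV (fun κ u => fun x z f b => ∑' w', φ ν y' w' * divV (fun μ' w'' => bsum L (W κ u μ' w'')) w' x z f b) w x z f b :=
    ⟨_, rfl⟩
  have gl : ∀ μ y ν y' f, (Summable fun x => l α x' f x * G μ y ν y' x f) ∧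
      |∑' x, l α x' f x * G μ y ν y' x f| ≤ KG * Real.exp (-(κ₀ / 6) * (supNorm (y' - y) + supNorm (x' - y) + supNorm (z - y))) := by
    intro μ y ν y' f
    have h := abs_gaugeLayer_le hL hκ hδ hgap ha haφ haρ hg hr hφ hl hWb hD₂ hD₁ μ y ν y' α x' z f b
    rw [hKG]
    subst hGdef
    exact h
  -- the base layers are summable (bounded double vertex against the kernel-leg envelope)
  have hrs : ∀ μ y κ, Summable fun v => r μ y κ v := fun μ y κ => summable_of_env hL hκ (hr μ y κ)
  have hXb : ∀ κ u κ' u' x z a b, |bsum L (W κ u κ' u') x z a b| ≤ (box (d + 1) L).card * CW := by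
    intro κ u κ' u' x z a b
    rw [bsum_apply]
    refine (Finset.abs_sum_le_sum_abs _ _).trans ((Finset.sum_le_sum fun t _ => hWb κ u κ' u' x _ a b).trans (le_of_eq ?_))
    rw [Finset.sum_const, nsmul_eq_mul]
  have BV : ∀ μ y ν y' x f, |vertex2W r (fun κ₁ v κ₂ v' => bsum L (W κ₁ v κ₂ v')) μ y ν y' x z f b|
      ≤ (∑ κ₁, ∑' v, |r μ y κ₁ v|) * ((∑ κ₂, ∑' v', |r ν y' κ₂ v'|) * ((box (d + 1) L).card * CW)) := by
    intro μ y ν y' x f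
    simp only [vertex2W]
    exact abs_vertexW_le_of_bdd (r := r) (T := fun κ w => vertexW r (fun κ₂ v' => bsum L (W κ w κ₂ v')) ν y') hrs (fun κ w x z a b =>
      abs_vertexW_le_of_bdd (r := r) (T := fun κ₂ v' => bsum L (W κ w κ₂ v')) hrs (fun lam v w₁ z₁ f₁ b₁ => hXb κ w lam v w₁ z₁ f₁ b₁) ν y' x z a b) μ y x z f b
  have bl : ∀ μ y ν y' f, Summable fun x => l α x' f x * vertex2W r (fun κ₁ v κ₂ v' => bsum L (W κ₁ v κ₂ v')) μ y ν y' x z f b :=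
    fun μ y ν y' f => summable_env_mul hL hκ (hl α x' f) (fun x => BV μ y ν y' x f)
  -- the dressed entry = base entry + gauge entry
  have eI : ∀ x, ∑ f, l α x' f x * ((1 / 2 : ℝ) *
        (vertex2W (fun μ y κ v => r μ y κ v + (φ μ y (v + unitVec κ) - φ μ y v)) (fun κ₁ v κ₂ v' => bsum L (W κ₁ v κ₂ v')) κ u κ' u' x z f b
          + vertex2W (fun μ y κ v => r μ y κ v + (φ μ y (v + unitVec κ) - φ μ y v)) (fun κ₁ v κ₂ v' => bsum L (W κ₁ v κ₂ v')) κ' u' κ u x z f b))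
      = ∑ f, l α x' f x * ((1 / 2 : ℝ) * (vertex2W r (fun κ₁ v κ₂ v' => bsum L (W κ₁ v κ₂ v')) κ u κ' u' x z f b
          + vertex2W r (fun κ₁ v κ₂ v' => bsum L (W κ₁ v κ₂ v')) κ' u' κ u x z f b))
        + ∑ f, (1 / 2 : ℝ) * (l α x' f x * G κ u κ' u' x f + l α x' f x * G κ' u' κ u x f) := by
    intro x
    rw [← Finset.sum_add_distrib]
    refine Finset.sum_congr rfl fun f _ => ?_
    rw [vertex2W_dressed_bsum_entry hL hκ hr hφ hWb κ u κ' u' x z f b, vertex2W_dressed_bsum_entry hL hκ hr hφ hWb κ' u' κ u x z f b]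
    subst hGdef
    ring
  have hSb : Summable fun x => ∑ f, l α x' f x * ((1 / 2 : ℝ) * (vertex2W r (fun κ₁ v κ₂ v' => bsum L (W κ₁ v κ₂ v')) κ u κ' u' x z f b
      + vertex2W r (fun κ₁ v κ₂ v' => bsum L (W κ₁ v κ₂ v')) κ' u' κ u x z f b)) := by
    refine summable_sum fun f _ => ?_
    have h := ((bl κ u κ' u' f).add (bl κ' u' κ u f)).mul_left (1 / 2 : ℝ)
    refine h.congr fun x => ?_
    ring
  have hSg : ∀ f, Summable fun x => (1 / 2 : ℝ) * (l α x' f x * G κ u κ' u' x f + l α x' f x * G κ' u' κ u x f) :=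
    fun f => ((gl κ u κ' u' f).1.add (gl κ' u' κ u f).1).mul_left _
  rw [legPush_inl, legPush_inl]
  simp_rw [eI]
  rw [hSb.tsum_add (summable_sum fun f _ => hSg f), add_sub_cancel_left]
  -- the two decays against the symmetric rate `κ₀/18`
  have hdec₁ : Real.exp (-(κ₀ / 6) * (supNorm (u' - u) + supNorm (x' - u) + supNorm (z - u))) ≤ Real.exp (-(κ₀ / 18) * S) := by
    rw [Real.exp_le_exp, hS]
    have := supNorm_nonneg (u' - u); have := supNorm_nonneg (x' - u); have := supNorm_nonneg (z - u)
    nlinarith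
  have hdec₂ : Real.exp (-(κ₀ / 6) * (supNorm (u - u') + supNorm (x' - u') + supNorm (z - u'))) ≤ Real.exp (-(κ₀ / 18) * S) := by
    rw [Real.exp_le_exp, hS]
    have h1 := supNorm_add_le (x' - u') (u' - u)
    have h2 := supNorm_add_le (z - u') (u' - u)
    rw [show x' - u' + (u' - u) = x' - u by abel] at h1
    rw [show z - u' + (u' - u) = z - u by abel] at h2
    have h3 := supNorm_sub_comm u u'
    have := supNorm_nonneg (u - u'); have := supNorm_nonneg (x' - u'); have := supNorm_nonneg (z - u')
    nlinarith
  have hterm : ∀ f, |∑' x, (1 / 2 : ℝ) * (l α x' f x * G κ u κ' u' x f + l α x' f x * G κ' u' κ u x f)| ≤ KG * Real.exp (-(κ₀ / 18) * S) := by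
    intro f
    rw [tsum_mul_left, (gl κ u κ' u' f).1.tsum_add (gl κ' u' κ u f).1, abs_mul, abs_of_pos (by norm_num : (0 : ℝ) < 1 / 2)]
    have h1 := (gl κ u κ' u' f).2.trans (mul_le_mul_of_nonneg_left hdec₁ hKG0)
    have h2 := (gl κ' u' κ u f).2.trans (mul_le_mul_of_nonneg_left hdec₂ hKG0)
    have h12 := (abs_add_le _ _).trans (add_le_add h1 h2)
    linarith
  rw [Summable.tsum_finsetSum (fun f _ => hSg f)]
  calc |∑ f, ∑' x, (1 / 2 : ℝ) * (l α x' f x * G κ u κ' u' x f + l α x' f x * G κ' u' κ u x f)|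
      ≤ ∑ f, |∑' x, (1 / 2 : ℝ) * (l α x' f x * G κ u κ' u' x f + l α x' f x * G κ' u' κ u x f)| := Finset.abs_sum_le_sum_abs _ _
    _ ≤ ∑ _f : Fib d, KG * Real.exp (-(κ₀ / 18) * S) := Finset.sum_le_sum fun f _ => hterm f
    _ = _ := by simp only [Finset.sum_const, Finset.card_univ, nsmul_eq_mul, hKG, hS]; ring

include hL hκ hδ hgap ha haφ haρ hg hr hφ hl hWb hD₂ hD₁ in
/-- NOT IN PRINT; OUR PROOF.  **THE DRESSED ONE-PUSH `LocStencil₂` BOUND, GIVEN THE BARE ONE**: if the bare push obeys the envelope bound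
`|legPush l r (bsum L ∘ W) κ u κ′ u′ x z (inl α) b| ≤ CB·e^{−(κ₀/18)·spread}` (e.g. `LegStepPush.abs_legPush_bsum_inl_le`), then
`LocStencil₂ (legPush l (r + d_zφ) (bsum L ∘ W)) (CB + |Fib d|·a_ρ·g′·(d+1)·(2a·a_φ + a_φ²(e^{3δ}+1))·K₀) (κ₀/(18(d+1)))` — the (E-a) window:
dressing the slot legs adds only `Cg(k₀)·g′` (slot-DIVERGENCE rows) to the constant, never a multiple of the table's `LocStencil₂` constant. -/
theorem locStencil₂_legPush_dressed_of_bare {CB : ℝ} (hCB : 0 ≤ CB)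
    (hB : ∀ κ u κ' u' x z α b, |legPush l r (fun κ₁ v κ₂ v' => bsum L (W κ₁ v κ₂ v')) κ u κ' u' x z (Sum.inl α) b|
      ≤ CB * Real.exp (-(κ₀ / 18) * (supNorm (u' - u) + supNorm (x - u) + supNorm (z - u)))) :
    LocStencil₂ (legPush l (fun μ y κ v => r μ y κ v + (φ μ y (v + unitVec κ) - φ μ y v)) (fun κ₁ v κ₂ v' => bsum L (W κ₁ v κ₂ v')))
      (CB + (Fintype.card (Fib d) : ℝ) * (aρ * g' * (((d : ℝ) + 1) * (2 * (a * aφ) + aφ * aφ * (Real.exp δ ^ 3 + 1))) *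
        (Real.exp κ₀ ^ 5 * Zl (d + 1) (δ / 2) ^ 3 * ((L : ℝ) ^ (d + 1) * Zl (d + 1) (κ₀ / (2 * ((d : ℝ) + 1)))))))
      (κ₀ / 3 / (6 * ((d : ℝ) + 1))) := by
  have hZ2 := Zl_nonneg (D := d + 1) (show 0 < δ / 2 by positivity)
  have hZκ := Zl_nonneg (D := d + 1) (show 0 < κ₀ / (2 * ((d : ℝ) + 1)) by positivity)
  refine locStencil₂_of_env_bound (by positivity) (by positivity) fun κ u κ' u' x z a₀ b => ?_
  rw [show -(κ₀ / 3 / 6) = -(κ₀ / 18) by ring]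
  rcases a₀ with α | ν
  · have h1 := hB κ u κ' u' x z α b
    have h2 := abs_legPush_dressed_sub_inl_le hL hκ hδ hgap ha haφ haρ hg hr hφ hl hWb hD₂ hD₁ κ u κ' u' x z α b
    have h3 := abs_sub_abs_le_abs_sub
      (legPush l (fun μ y κ v => r μ y κ v + (φ μ y (v + unitVec κ) - φ μ y v)) (fun κ₁ v κ₂ v' => bsum L (W κ₁ v κ₂ v')) κ u κ' u' x z (Sum.inl α) b)
      (legPush l r (fun κ₁ v κ₂ v' => bsum L (W κ₁ v κ₂ v')) κ u κ' u' x z (Sum.inl α) b)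
    rw [add_mul]
    linarith
  · rw [legPush_inr, abs_zero]; positivity

end Dressed

section Window

variable {L : ℕ} {κ₀ δ a a' aφ aρ C g g' CW : ℝ}
  {l : Fin (d + 1) → (Fin (d + 1) → ℤ) → Fib d → (Fin (d + 1) → ℤ) → ℝ}
  {r : Fin (d + 1) → (Fin (d + 1) → ℤ) → Fin (d + 1) → (Fin (d + 1) → ℤ) → ℝ}
  {φ : Fin (d + 1) → (Fin (d + 1) → ℤ) → (Fin (d + 1) → ℤ) → ℝ} {W : Tab d}
  (hL : 1 ≤ L) (hκ : 0 < κ₀) (hδ : 0 < δ) (hgap : κ₀ ≤ δ / 6 * L)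
  (ha : 0 ≤ a) (ha' : 0 ≤ a') (haφ : 0 ≤ aφ) (haρ : 0 ≤ aρ) (hg : 0 ≤ g) (hg' : 0 ≤ g')
  (hr : ∀ μ y κ v, |r μ y κ v| ≤ a * Real.exp (-(κ₀ * supNorm (quo L v - y))))
  (hr' : ∀ μ y κ v i, |r μ y κ (v + Pi.single i 1) - r μ y κ v| ≤ a' * Real.exp (-(κ₀ * supNorm (quo L v - y))))
  (hφ : ∀ μ y v, |φ μ y v| ≤ aφ * Real.exp (-(κ₀ * supNorm (quo L v - y))))
  (hl : ∀ α x' f x, |l α x' f x| ≤ aρ * Real.exp (-(κ₀ * supNorm (quo L x - x'))))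
  (hW : LocStencil₂ W C δ) (hWb : ∀ κ u κ' u' x z a b, |W κ u κ' u' x z a b| ≤ CW)
  (hq₂ : ∀ κ₁ v κ₂ x p f b, |∑' v', W κ₁ v κ₂ v' x p f b| ≤ g * Real.exp (-δ * (l1 (x - v) + l1 (p - v))))
  (hq₁ : ∀ κ₁ κ₂ v' x p f b, |∑' v, W κ₁ v κ₂ v' x p f b| ≤ g * Real.exp (-δ * (l1 (x - v') + l1 (p - v'))))
  (hq₁₂ : ∀ κ₁ κ₂ x p f b, |∑' v, ∑' v', W κ₁ v κ₂ v' x p f b| ≤ g * Real.exp (-δ * l1 (p - x)))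
  (hD₂ : ∀ κ v w x p f b, |∑ μ, (W κ v μ (w - unitVec μ) x p f b - W κ v μ w x p f b)|
    ≤ g' * Real.exp (-δ * l1 (w - v)) * Real.exp (-δ * (l1 (x - v) + l1 (p - v))))
  (hD₁ : ∀ κ' w v' x p f b, |∑ κ, (W κ (w - unitVec κ) κ' v' x p f b - W κ w κ' v' x p f b)|
    ≤ g' * Real.exp (-δ * l1 (v' - w)) * Real.exp (-δ * (l1 (x - w) + l1 (p - w))))

include hL hκ hδ hgap ha ha' haφ haρ hg hg' hr hr' hφ hl hW hWb hq₂ hq₁ hq₁₂ hD₂ hD₁ in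
/-- NOT IN PRINT; OUR PROOF.  **THE (E-a) WINDOW — THE DRESSED ONE-PUSH `LocStencil₂` BOUND**: the three-leg push of a block-summed `LocStencil₂` table with
bounded slot CHARGES (`g`) and bounded slot DIVERGENCES (`g′`) through a kernel leg (sup `a_ρ`) and DRESSED slot legs `r + d_zφ` (bare part: sup `a`, unit
gradient `a′` — double first-moment freezing, `LegStepPush`; gauge part: potential sup `a_φ` — no freezing, this file):
`LocStencil₂ (legPush l (r + d_zφ) (bsum L ∘ W)) (|Fib d|·(d+1)²·a_ρ·Jc·L^{d+1}·Zl + |Fib d|·a_ρ·g′·(d+1)·(2a·a_φ + a_φ²(e^{3δ}+1))·K₀) (κ₀/(18(d+1)))`. -/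
theorem locStencil₂_legPush_dressed_bsum :
    LocStencil₂ (legPush l (fun μ y κ v => r μ y κ v + (φ μ y (v + unitVec κ) - φ μ y v)) (fun κ₁ v κ₂ v' => bsum L (W κ₁ v κ₂ v')))
      ((Fintype.card (Fib d) : ℝ) * ((d : ℝ) + 1) ^ 2 *
        (aρ * ((Real.exp κ₀ * Zl (d + 1) (δ / 6)) *
          (a' ^ 2 * C * Real.exp κ₀ ^ 2 * (2 / (δ / 6) * Zl (d + 1) (δ / 6 / 2)) ^ 2
            + 2 * (a * a' * g * Real.exp κ₀ * (2 / (δ / 6) * Zl (d + 1) (δ / 6 / 2))) + a ^ 2 * g)) *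
        ((L : ℝ) ^ (d + 1) * Zl (d + 1) (κ₀ / (2 * ((d : ℝ) + 1)))))
       + (Fintype.card (Fib d) : ℝ) * (aρ * g' * (((d : ℝ) + 1) * (2 * (a * aφ) + aφ * aφ * (Real.exp δ ^ 3 + 1))) *
        (Real.exp κ₀ ^ 5 * Zl (d + 1) (δ / 2) ^ 3 * ((L : ℝ) ^ (d + 1) * Zl (d + 1) (κ₀ / (2 * ((d : ℝ) + 1)))))))
      (κ₀ / 3 / (6 * ((d : ℝ) + 1))) := by
  have hC : 0 ≤ C := hW.nonneg
  have hZ := Zl_nonneg (D := d + 1) (show 0 < δ / 6 by positivity)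
  have hZ' := Zl_nonneg (D := d + 1) (show 0 < δ / 6 / 2 by positivity)
  have hZκ := Zl_nonneg (D := d + 1) (show 0 < κ₀ / (2 * ((d : ℝ) + 1)) by positivity)
  exact locStencil₂_legPush_dressed_of_bare hL hκ hδ hgap ha haφ haρ hg' hr hφ hl hWb hD₂ hD₁ (by positivity)
    fun κ u κ' u' x z α b => abs_legPush_bsum_inl_le hL hκ hδ hgap ha ha' haρ hg hr hr' hl hW hq₂ hq₁ hq₁₂ κ u κ' u' x z α b

end Window

end Summit.QuantumFields.BalabanUV.Beta.GAN24.LegPushDressedBound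

end
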